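import Summits.QuantumFields.YangMills.Theorems.BalabanUVNodesN15PerCubeGreenFineAdjointRows
import Summits.QuantumFields.YangMills.Theorems.BalabanUVNodesN15PerCubeGreenAdjointRightEntriesTwoGrid
import HarnessLib

/-!
# N15 = NE2, road (c) — PROGRAMME (PC), (PC-E-K) ENTRY 2 «`G′(U)∇*_U` of [B9] (3.42), TWO GRIDS»: THE SITE KIT OF THE ADJOINT KNIT AT THE FINE GRID `ScX′`, part 2 — THE SANDWICHED
# RIGHT ENTRIES `N′_k∘∇^±_μ∘M_{χ′_k} = T^±_k∘M_{χ′_k}`, `T^±_k := M_{ψ′_k}∘(G′(1)∘∇^±_μ)∘M_{ψ′_k}`, AND THEIR ROWS FROM THE FLAT RIGHT ENTRY `G′(1)∂ᵀ`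
# (dag-n15-c g37, n15-c∕428c; the LITERAL `ScX′` twin of n15-c∕282b `…PerCubeGreenAdjointRightEntries`)

Cell `pub-ymgap`, seat `pub-ymgap-dag-n15-c` (generation g37; R134 (a), s1; HUMAN RULING D-0062).  `bears_on: R4∕N15 · K3⁸ SpineGivenEndpointR13SepCoPHV (stmt-QuantumFields-27366)`;
filed `--kind proof --supports stmt-QuantumFields-27366 --as helper` — COUNT-NEUTRAL.  Theorems only; 0 `def`, 0 `sorry`.  Imports BY NAME n15-c∕428b `…PerCubeGreenFineAdjointRows`
(the margins `mulOp_scChi'_comp_mulOp_scPsi'`, `mulOp_scPsi'_comp_fgrad∕bgrad_comp_mulOp_scChi'`) and n15-c∕428a `…PerCubeGreenAdjointRightEntriesTwoGrid` (`mulVecLin_comp_bgrad_gen`: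
`G∘∇⁻_μ = −(G∂ᵀ)∘ext_μ` on ANY `Tor (fine n M)` — used here at `n = L^rL^k` instead of restating n15-c∕282b's `mulVecLin_comp_bgrad_eq`; through it n15-c∕282b's generic
`fgrad_eq_bgrad_comp_pull`, lit `hasMaj_id_ofBlocks`, `hasMaj_pull ∕ hasMaj_mulOp`, dag-n15-c `hasMaj_pull_comp`, n15-c∕326 `tdistT_scBlk'_scShift'_le`, `mulOp_scPsi'_idem`).  Nothing in
the tree is modified; nothing restated (FINE carrier `ScX′`; n15-c∕282b's statements live on `ScX`).

WHY ∕ WHAT (twins of n15-c∕282b, same names primed).  `hasMaj_ext'` (`ext_μ ≤ diag 1`), `hasMaj_scShift'_pull` (`S_μ ≤ e^{ρ}e^{−ρd}`), ★★ `hasMaj_mulVecLin_comp_bgrad'` ∕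
`hasMaj_mulVecLin_comp_fgrad'` (the rows of `G∘∇^∓_μ` from the flat right entry `G∂ᵀ ≤ Ce^{−δd}` — dag-n15-a Ξ-4 r3 at `n = r`), ★★ `scCubeP'_fgrad∕bgrad_sandwich` ([hTf]∕[hTb] at the
fine grid), `scT'_comp_mulOp_scPsi'`, ★★ `hasMaj_scT'` (the two-sided row of `T_k`).  Consumed by the site knit of n15-c∕427 (n15-c∕429, fine half).

HONEST FRAMING ∕ LIMITS.  Lattice plumbing on the MODEL site carrier of the fine grid; the flat right-entry row is a HYPOTHESIS in Ξ-4's shape; nothing of [B5]∕[B6]∕[B9] asserted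
((3.42) p.397 at `U ≡ 1`, (3.62)–(3.65) pp.402–403, [B6-II] (2.133) p.247 = SHAPES).  NE2⁺ NOT PRINTED, NOT proved; N15 of record untouched (DISCHARGED AS CONSUMED, p687738); K3⁸
OPEN; counts of record UNMOVED (typed 28∕28 · discharged 8∕27); one finite 𝕋⁴ at fixed ε per index — NOT infinite volume, NOT OS on ℝ⁴, NOT a mass gap, NOT Clay.  Restate-immune.
-/

noncomputable section

open scoped BigOperators Matrix

namespace Summit.QuantumFields.YangMills.BalabanUVNodes.N15.Gluing

open Real
open Literature.MathematicalPhysics.QuantumFieldTheory.Balaban1983to89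
open Literature.MathematicalPhysics.QuantumFieldTheory.Balaban1983to89.B5Prop11Plancherel (Tor fine unitVec)
open Literature.MathematicalPhysics.QuantumFieldTheory.Balaban1983to89.B11SectG (BlockNorm HasMaj RowSum hasMaj_comp_exp)
open Literature.MathematicalPhysics.QuantumFieldTheory.Balaban1983to89.B6RandomWalk (Triangle254)
open Literature.MathematicalPhysics.QuantumFieldTheory.Balaban1983to89.B6Prop26Gluing (mulOp mulOp_apply ind ind_nonneg)
open Literature.MathematicalPhysics.QuantumFieldTheory.Balaban1983to89.B6UnitTorusCarrier (unitTorusGeo unitTorusGeo_dist unitTorusGeo_dist_self unitTorusGeo_dist_nonneg triangle254_unitTorusGeo)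
open Literature.MathematicalPhysics.QuantumFieldTheory.Balaban1983to89.B9Eq3130MatrixLetters (hasMaj_id_ofBlocks)
open Literature.MathematicalPhysics.QuantumFieldTheory.Balaban1983to89.T4EtaRateCoeffDefect (pull pull_apply diagK diagK_nonneg hasMaj_pull hasMaj_mulOp)
open Literature.MathematicalPhysics.QuantumFieldTheory.King1986.Torus (blockOf tdistT tdistT_nonneg tdistT_triangle tdistT_symm)
open Summit.QuantumFields.YangMills.BalabanUVNodes.N15.BackgroundLayer (fgrad bgrad fgrad_apply bgrad_apply)
open Summit.QuantumFields.YangMills.BalabanUVNodes.N15.MatrixSpecies (liftBlk liftEquiv liftEquiv_apply liftEquiv_symm_apply)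
open Summit.QuantumFields.YangMills.BalabanUVNodes.N15.VectorPiece (bshiftEquiv hasMaj_pull_comp)
open Summit.QuantumFields.YangMills.BalabanUVNodes.N15.TwoGrid (chiCube cubeBlocks chiCube_of_not_mem abs_chiCube_le_one)
open Summit.QuantumFields.YangMills.BalabanUVNodes.N15.CurvedSpecies (mulOp_comp_fgrad_comp_mulOp_of_margin mulOp_comp_bgrad_comp_mulOp_of_margin mulOp_comp_lapOp_comp_mulOp)
open Summit.QuantumFields.YangMills.BalabanUVNodes.N15.CovLandau (cgrad cGreen bBack cgrad_mulVec cgrad_one_transpose_mulVec)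

variable {d : ℕ}

/-! ## §3 The sandwiched right entries of `N′_k` and their rows from the flat right entry `G′(1)∂ᵀ` -/

section RightEntries

variable {L : ℕ} [NeZero L] {mv kk r : ℕ} {hL : Odd L ∧ 1 < L} (ι : Type) [Fintype ι] [DecidableEq ι]

omit [DecidableEq ι] in
/-- `ext_μ ≤ diag 1` from the site block norm to the bond block norm (the component embedding is an isometry blockwise). [folklore] -/
theorem hasMaj_ext' (μ : Fin (d + 1)) :
    HasMaj (ScNorm' d L mv kk r hL ι) (BlockNorm.ofBlocks (unitTorusGeo L kk (cvM d L mv kk hL)) (liftBlk (fun b : ScX' d L mv kk r hL × Fin (d + 1) => blockOf (L ^ r * L ^ kk) (cvM d L mv kk hL) b.1) ι))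
      (mulOp (fun b : (ScX' d L mv kk r hL × Fin (d + 1)) × ι => if b.1.2 = μ then (1 : ℝ) else 0) ∘ₗ pull (fun b : (ScX' d L mv kk r hL × Fin (d + 1)) × ι => (b.1.1, b.2)))
      (fun y y' => (1 : ℝ) * diagK (fun _ => (1 : ℝ)) y y') := by
  have hp : HasMaj (ScNorm' d L mv kk r hL ι) (BlockNorm.ofBlocks (unitTorusGeo L kk (cvM d L mv kk hL)) (liftBlk (fun b : ScX' d L mv kk r hL × Fin (d + 1) => blockOf (L ^ r * L ^ kk) (cvM d L mv kk hL) b.1) ι))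
      (pull (fun b : (ScX' d L mv kk r hL × Fin (d + 1)) × ι => (b.1.1, b.2))) (diagK fun _ => (1 : ℝ)) :=
    hasMaj_pull (g := unitTorusGeo L kk (cvM d L mv kk hL)) (liftBlk (scBlk' d L mv kk r hL) ι) (fun b : (ScX' d L mv kk r hL × Fin (d + 1)) × ι => (b.1.1, b.2))
  have hm : HasMaj (BlockNorm.ofBlocks (unitTorusGeo L kk (cvM d L mv kk hL)) (liftBlk (fun b : ScX' d L mv kk r hL × Fin (d + 1) => blockOf (L ^ r * L ^ kk) (cvM d L mv kk hL) b.1) ι))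
      (BlockNorm.ofBlocks (unitTorusGeo L kk (cvM d L mv kk hL)) (liftBlk (fun b : ScX' d L mv kk r hL × Fin (d + 1) => blockOf (L ^ r * L ^ kk) (cvM d L mv kk hL) b.1) ι))
      (mulOp (fun b : (ScX' d L mv kk r hL × Fin (d + 1)) × ι => if b.1.2 = μ then (1 : ℝ) else 0)) (diagK fun _ => (1 : ℝ)) :=
    hasMaj_mulOp (g := unitTorusGeo L kk (cvM d L mv kk hL)) _ (m := fun _ => (1 : ℝ)) (fun _ => zero_le_one) fun b => by split_ifs <;> simp
  exact hasMaj_diag_comp _ (fun _ => zero_le_one) hm hp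

omit [DecidableEq ι] in
/-- the lifted site shift `S_μ ≤ e^{ρ}·e^{−ρ|y−y′|_T}` (`ρ ≥ 0`): one site step moves the unit block by at most one. [folklore] -/
theorem hasMaj_scShift'_pull {ρ : ℝ} (hρ : 0 ≤ ρ) (μ : Fin (d + 1)) :
    HasMaj (ScNorm' d L mv kk r hL ι) (ScNorm' d L mv kk r hL ι) (pull ⇑(liftEquiv (scShift' d L mv kk r hL μ) ι))
      (fun y y' => Real.exp ρ * Real.exp (-(ρ * (unitTorusGeo L kk (cvM d L mv kk hL)).dist y y'))) := by
  have hid := hasMaj_id_ofBlocks (g := unitTorusGeo L kk (cvM d L mv kk hL)) (liftBlk (scBlk' d L mv kk r hL) ι) (fun y => unitTorusGeo_dist_self L kk _ y) ρ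
  have h := hasMaj_pull_comp (g := unitTorusGeo L kk (cvM d L mv kk hL)) (liftBlk (scBlk' d L mv kk r hL) ι) ⇑(liftEquiv (scShift' d L mv kk r hL μ) ι)
    (K' := fun y y' => Real.exp ρ * Real.exp (-(ρ * (unitTorusGeo L kk (cvM d L mv kk hL)).dist y y'))) (fun _ _ => by positivity) (fun p y' => ?_) hid
  · rw [LinearMap.comp_id] at h; exact h
  · show 1 * Real.exp (-(ρ * tdistT (cvM d L mv kk hL) (scBlk' d L mv kk r hL (scShift' d L mv kk r hL μ p.1)) y')) ≤
      Real.exp ρ * Real.exp (-(ρ * tdistT (cvM d L mv kk hL) (scBlk' d L mv kk r hL p.1) y'))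
    rw [one_mul, ← Real.exp_add]
    refine Real.exp_le_exp.mpr ?_
    have h1 := tdistT_triangle (cvM d L mv kk hL) (scBlk' d L mv kk r hL p.1) (scBlk' d L mv kk r hL (scShift' d L mv kk r hL μ p.1)) y'
    have h2 : tdistT (cvM d L mv kk hL) (scBlk' d L mv kk r hL p.1) (scBlk' d L mv kk r hL (scShift' d L mv kk r hL μ p.1)) ≤ 1 := by
      have := tdistT_scBlk'_scShift'_le (d := d) (L := L) (mv := mv) (kk := kk) (r := r) (hL := hL) μ p.1
      rwa [unitTorusGeo_dist, tdistT_symm] at this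
    nlinarith

/-- ★★ **THE BACKWARD RIGHT ENTRY's ROW**: `G∘∇⁻_μ ≤ C·e^{−δ|y−y′|_T}` on sites from the flat right entry `G∂ᵀ ≤ Ce^{−δ|y−y′|_T}` (bond-to-site; dag-n15-a Ξ-4 r3 for `G = G′(1)`).
[cite: Balaban1985BackgroundPropagators, Thm 3.1 (3.42) p.397 (entry `G′∇*` at `U ≡ 1`: shape); King1986, Thm 3.3 (3.8) p.656] -/
theorem hasMaj_mulVecLin_comp_bgrad' {G : Matrix (ScX' d L mv kk r hL × ι) (ScX' d L mv kk r hL × ι) ℝ} {C δ : ℝ} (hC : 0 ≤ C)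
    (hA : HasMaj (BlockNorm.ofBlocks (unitTorusGeo L kk (cvM d L mv kk hL)) (liftBlk (fun b : ScX' d L mv kk r hL × Fin (d + 1) => blockOf (L ^ r * L ^ kk) (cvM d L mv kk hL) b.1) ι)) (ScNorm' d L mv kk r hL ι)
      (Matrix.mulVecLin (G * (cgrad (cvM d L mv kk hL) (L ^ r * L ^ kk) (fun (_ : Fin (d + 1)) (_ : ScX' d L mv kk r hL) => (1 : Matrix ι ι ℝ)))ᵀ)) (fun y y' => C * Real.exp (-(δ * tdistT (cvM d L mv kk hL) y y'))))
    (μ : Fin (d + 1)) :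
    HasMaj (ScNorm' d L mv kk r hL ι) (ScNorm' d L mv kk r hL ι) (Matrix.mulVecLin G ∘ₗ bgrad (((L ^ r * L ^ kk : ℕ) : ℝ)) (liftEquiv (scShift' d L mv kk r hL μ) ι))
      (fun y y' => C * Real.exp (-(δ * (unitTorusGeo L kk (cvM d L mv kk hL)).dist y y'))) := by
  erw [mulVecLin_comp_bgrad_gen (M := cvM d L mv kk hL) (n := L ^ r * L ^ kk) ι G μ]
  refine ((hasMaj_comp_diag _ (fun y y' => mul_nonneg hC (Real.exp_nonneg _)) hA ((hasMaj_ext' ι μ).mono fun y y' => le_of_eq (one_mul _))).neg).mono fun y y' => le_of_eq ?_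
  rw [unitTorusGeo_dist, mul_one]

/-- ★★ **THE FORWARD RIGHT ENTRY's ROW**: `G∘∇⁺_μ = (G∘∇⁻_μ)∘S_μ ≤ C·e^{δ}c_r·e^{−(δ−σ)|y−y′|_T}` (one site shift, rate `σ` for the row sum). [cite: Balaban1985BackgroundPropagators, Thm 3.1 (3.42) p.397 (entry `G′∇*` at `U ≡ 1`: shape)] -/
theorem hasMaj_mulVecLin_comp_fgrad' {G : Matrix (ScX' d L mv kk r hL × ι) (ScX' d L mv kk r hL × ι) ℝ} {C δ σ cr : ℝ} (hC : 0 ≤ C) (hδσ : σ ≤ δ) (hσ : 0 ≤ σ)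
    (hrow : RowSum (unitTorusGeo L kk (cvM d L mv kk hL)) σ cr)
    (hA : HasMaj (BlockNorm.ofBlocks (unitTorusGeo L kk (cvM d L mv kk hL)) (liftBlk (fun b : ScX' d L mv kk r hL × Fin (d + 1) => blockOf (L ^ r * L ^ kk) (cvM d L mv kk hL) b.1) ι)) (ScNorm' d L mv kk r hL ι)
      (Matrix.mulVecLin (G * (cgrad (cvM d L mv kk hL) (L ^ r * L ^ kk) (fun (_ : Fin (d + 1)) (_ : ScX' d L mv kk r hL) => (1 : Matrix ι ι ℝ)))ᵀ)) (fun y y' => C * Real.exp (-(δ * tdistT (cvM d L mv kk hL) y y'))))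
    (μ : Fin (d + 1)) :
    HasMaj (ScNorm' d L mv kk r hL ι) (ScNorm' d L mv kk r hL ι) (Matrix.mulVecLin G ∘ₗ fgrad (((L ^ r * L ^ kk : ℕ) : ℝ)) (liftEquiv (scShift' d L mv kk r hL μ) ι))
      (fun y y' => C * Real.exp δ * cr * Real.exp (-((δ - σ) * (unitTorusGeo L kk (cvM d L mv kk hL)).dist y y'))) := by
  rw [fgrad_eq_bgrad_comp_pull, ← LinearMap.comp_assoc]
  have h := hasMaj_comp_exp (b₁ := ScNorm' d L mv kk r hL ι) (b₂ := ScNorm' d L mv kk r hL ι) (b₃ := ScNorm' d L mv kk r hL ι) (ρ := δ - σ)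
    (triangle254_unitTorusGeo L kk _) (unitTorusGeo_dist_nonneg L kk _) hrow hC (Real.exp_nonneg δ) (by linarith) (by linarith) (by linarith)
    (hasMaj_mulVecLin_comp_bgrad' ι hC hA μ) (hasMaj_scShift'_pull ι (hσ.trans hδσ) μ)
  refine h.mono fun y y' => le_of_eq ?_
  rw [show (ScNorm' d L mv kk r hL ι).κ = 1 from rfl]; ring

variable (hM : ∀ ν, cvM d L mv kk hL ν = 2 * L * L ^ mv) (hm₁ : 2 * L ^ mv ≤ coverMargin L mv) (hfitI : coverMargin L mv - 2 * L ^ mv + (6 * L ^ mv + 1) ≤ L * L ^ mv)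
  (hm₂ : 2 * L ^ mv + 1 ≤ coverMargin L mv) (hfit₂ : coverMargin L mv - 2 * L ^ mv + (6 * L ^ mv + 1) + 1 ≤ L * L ^ mv) (hS0 : L * L ^ mv ≤ 2 * L * L ^ mv)
include hM hm₁ hfitI hm₂ hfit₂ hS0

omit hm₁ hfitI in
/-- ★★ **THE FORWARD SANDWICH** [hTf]: `N′_k∘∇⁺_μ∘M_{χ_k} = T⁺_k∘M_{χ_k}` with `T⁺_k := M_{ψ_k}∘(G′(1)∘∇⁺_μ)∘M_{ψ_k}` (the margin: `M_ψ∇⁺M_χ = ∇⁺M_χ`, `M_ψM_χ = M_χ`).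
[cite: Balaban1985BackgroundPropagators, (3.62)–(3.65) pp.402–403; Balaban1984PropagatorsII, (2.133) p.247 (shape)] -/
theorem scCubeP'_fgrad_sandwich (a cc : ℝ) (μ : Fin (d + 1)) (k : Fin (d + 1) → ZMod (2 * L)) :
    (mulOp (fun p : ScX' d L mv kk r hL × ι => scPsi' d L mv kk r hL k p.1) ∘ₗ scCube' d L mv kk r hL a ι k) ∘ₗ fgrad cc (liftEquiv (scShift' d L mv kk r hL μ) ι) ∘ₗ
        mulOp (fun p : ScX' d L mv kk r hL × ι => scChi' d L mv kk r hL k p.1) =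
      (mulOp (fun p : ScX' d L mv kk r hL × ι => scPsi' d L mv kk r hL k p.1) ∘ₗ
          (Matrix.mulVecLin (cGreen (cvM d L mv kk hL) (L ^ r * L ^ kk) (fun (_ : Fin (d + 1)) (_ : ScX' d L mv kk r hL) => (1 : Matrix ι ι ℝ)) a) ∘ₗ fgrad cc (liftEquiv (scShift' d L mv kk r hL μ) ι)) ∘ₗ
          mulOp (fun p : ScX' d L mv kk r hL × ι => scPsi' d L mv kk r hL k p.1)) ∘ₗ
        mulOp (fun p : ScX' d L mv kk r hL × ι => scChi' d L mv kk r hL k p.1) := by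
  have hψχ : mulOp (fun p : ScX' d L mv kk r hL × ι => scPsi' d L mv kk r hL k p.1) ∘ₗ mulOp (fun p : ScX' d L mv kk r hL × ι => scChi' d L mv kk r hL k p.1) =
      mulOp (fun p : ScX' d L mv kk r hL × ι => scChi' d L mv kk r hL k p.1) := by
    rw [mulOp_comp_mulOp_comm]; exact mulOp_scChi'_comp_mulOp_scPsi' ι hM hm₂ hfit₂ hS0 k
  simp only [scCube', LinearMap.comp_assoc]
  rw [mulOp_scPsi'_comp_fgrad_comp_mulOp_scChi' ι hM hm₂ hfit₂ hS0, hψχ]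

omit hm₁ hfitI in
/-- ★★ **THE BACKWARD SANDWICH** [hTb]: `N′_k∘∇⁻_μ∘M_{χ_k} = T⁻_k∘M_{χ_k}`, `T⁻_k := M_{ψ_k}∘(G′(1)∘∇⁻_μ)∘M_{ψ_k}`. [cite: Balaban1985BackgroundPropagators, (3.62)–(3.65) pp.402–403; Balaban1984PropagatorsII, (2.133) p.247 (shape)] -/
theorem scCubeP'_bgrad_sandwich (a cc : ℝ) (μ : Fin (d + 1)) (k : Fin (d + 1) → ZMod (2 * L)) :
    (mulOp (fun p : ScX' d L mv kk r hL × ι => scPsi' d L mv kk r hL k p.1) ∘ₗ scCube' d L mv kk r hL a ι k) ∘ₗ bgrad cc (liftEquiv (scShift' d L mv kk r hL μ) ι) ∘ₗ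
        mulOp (fun p : ScX' d L mv kk r hL × ι => scChi' d L mv kk r hL k p.1) =
      (mulOp (fun p : ScX' d L mv kk r hL × ι => scPsi' d L mv kk r hL k p.1) ∘ₗ
          (Matrix.mulVecLin (cGreen (cvM d L mv kk hL) (L ^ r * L ^ kk) (fun (_ : Fin (d + 1)) (_ : ScX' d L mv kk r hL) => (1 : Matrix ι ι ℝ)) a) ∘ₗ bgrad cc (liftEquiv (scShift' d L mv kk r hL μ) ι)) ∘ₗ
          mulOp (fun p : ScX' d L mv kk r hL × ι => scPsi' d L mv kk r hL k p.1)) ∘ₗ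
        mulOp (fun p : ScX' d L mv kk r hL × ι => scChi' d L mv kk r hL k p.1) := by
  have hψχ : mulOp (fun p : ScX' d L mv kk r hL × ι => scPsi' d L mv kk r hL k p.1) ∘ₗ mulOp (fun p : ScX' d L mv kk r hL × ι => scChi' d L mv kk r hL k p.1) =
      mulOp (fun p : ScX' d L mv kk r hL × ι => scChi' d L mv kk r hL k p.1) := by
    rw [mulOp_comp_mulOp_comm]; exact mulOp_scChi'_comp_mulOp_scPsi' ι hM hm₂ hfit₂ hS0 k
  simp only [scCube', LinearMap.comp_assoc]
  rw [mulOp_scPsi'_comp_bgrad_comp_mulOp_scChi' ι hM hm₂ hfit₂ hS0, hψχ]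

omit [Fintype ι] [DecidableEq ι] hM hm₁ hfitI hm₂ hfit₂ hS0 in
/-- [hTfψ]∕[hTbψ]: `T_k∘M_{ψ_k} = T_k` for `T_k = M_ψ∘R∘M_ψ` (any `R`). [folklore] -/
theorem scT'_comp_mulOp_scPsi' (R : (ScX' d L mv kk r hL × ι → ℝ) →ₗ[ℝ] (ScX' d L mv kk r hL × ι → ℝ)) (k : Fin (d + 1) → ZMod (2 * L)) :
    (mulOp (fun p : ScX' d L mv kk r hL × ι => scPsi' d L mv kk r hL k p.1) ∘ₗ R ∘ₗ mulOp (fun p : ScX' d L mv kk r hL × ι => scPsi' d L mv kk r hL k p.1)) ∘ₗ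
        mulOp (fun p : ScX' d L mv kk r hL × ι => scPsi' d L mv kk r hL k p.1) =
      mulOp (fun p : ScX' d L mv kk r hL × ι => scPsi' d L mv kk r hL k p.1) ∘ₗ R ∘ₗ mulOp (fun p : ScX' d L mv kk r hL × ι => scPsi' d L mv kk r hL k p.1) := by
  rw [LinearMap.comp_assoc, LinearMap.comp_assoc, mulOp_scPsi'_idem]

omit [DecidableEq ι] hM hm₁ hfitI hm₂ hfit₂ hS0 in
/-- ★★ **THE TWO-SIDED ROW OF `T_k = M_{ψ_k}∘R∘M_{ψ_k}`** [hTfr]∕[hTbr]: `R ≤ B·e^{−ρd}` ⟹ `T_k ≤ 1_□1_□·Be^{−ρd}`. [cite: Balaban1984PropagatorsII, (2.133) p.247 (shape)] -/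
theorem hasMaj_scT' {R : (ScX' d L mv kk r hL × ι → ℝ) →ₗ[ℝ] (ScX' d L mv kk r hL × ι → ℝ)} {B ρ : ℝ} (hB : 0 ≤ B)
    (hR : HasMaj (ScNorm' d L mv kk r hL ι) (ScNorm' d L mv kk r hL ι) R (fun y y' => B * Real.exp (-(ρ * (unitTorusGeo L kk (cvM d L mv kk hL)).dist y y')))) (k : Fin (d + 1) → ZMod (2 * L)) :
    HasMaj (ScNorm' d L mv kk r hL ι) (ScNorm' d L mv kk r hL ι)
      (mulOp (fun p : ScX' d L mv kk r hL × ι => scPsi' d L mv kk r hL k p.1) ∘ₗ R ∘ₗ mulOp (fun p : ScX' d L mv kk r hL × ι => scPsi' d L mv kk r hL k p.1))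
      (fun y y' => ind (cvSk d L mv kk hL k) y * ind (cvSk d L mv kk hL k) y' * (B * Real.exp (-(ρ * (unitTorusGeo L kk (cvM d L mv kk hL)).dist y y')))) := by
  have h1 := hasMaj_comp_mulOp_cut (b₂ := ScNorm' d L mv kk r hL ι) (liftBlk (scBlk' d L mv kk r hL) ι) (fun y y' => by positivity) (S := cvSk d L mv kk hL k)
    (χ := fun p : ScX' d L mv kk r hL × ι => scPsi' d L mv kk r hL k p.1) (fun p => abs_chiCube_le_one _ _) (fun p hp => Finset.mem_coe.mpr (by by_contra h; exact hp (chiCube_of_not_mem h))) hR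
  have h2 := hasMaj_mulOp_cut_comp (b₁ := ScNorm' d L mv kk r hL ι) (liftBlk (scBlk' d L mv kk r hL) ι) (fun y y' => mul_nonneg (ind_nonneg _ _) (by positivity)) (S := cvSk d L mv kk hL k)
    (χ := fun p : ScX' d L mv kk r hL × ι => scPsi' d L mv kk r hL k p.1) (fun p => abs_chiCube_le_one _ _)
    (fun p hp => Finset.mem_coe.mpr (by by_contra h; exact hp (chiCube_of_not_mem h))) h1
  rw [← LinearMap.comp_assoc] at h2
  rw [← LinearMap.comp_assoc]
  exact h2.mono fun y y' => le_of_eq (by ring)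

end RightEntries


end Summit.QuantumFields.YangMills.BalabanUVNodes.N15.Gluing

end
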